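import Mathlib
import Summits.ValiantsHypothesis.ValiantsHypothesis.Theorems.FifoMatchingNNDivisionHardFewGeneratorsTransport
import Summits.ValiantsHypothesis.ValiantsHypothesis.Theorems.FifoMatchingNNDivisionHardFaceBlindFewZones
import HarnessLib

/-!
# The K1/AFHMS transport of `Newt(NN_n) + Z` for a ZONOTOPE passenger `Z`, WITH ITS NUMBER OF ZONES (crux
# `Theses.FifoMatching.NNDivisionHard`, stmt-ValiantsHypothesis-21181; the zonotope chapter in the NN currency)

WHAT IS NEW.  At the COR level the tree DECIDES zonotope passengers with few ZONES and ARBITRARY zone vectors: ✓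
`…FaceBlindFewZones.fewZones_decided` (val-idea-41's FEW-ZONES LAW in kernel: `Z = w + Σ_{i<M} [0,1]·gen i`,
`M·C(h−t−1,t−1) < C(h−1,t−1)`, `(2(log₂h+C)^C+4)·t ≤ h` ⇒ `2^((log₂ h+C)^C) < xc(COR(K_h) + Z)`; up to `2^{h^{1−o(1)}}` zones, i.e.
exponentially MORE than the `1.22^{h/2}` generators of PROP A).  In the NN currency nothing used it: the named survivor of every
NN-currency tier so far (leafhand-8-g1's census) is the ZONOTOPE-LIKE cofactor `hh = Π_i p_i` with few-nomial factors and MANY factors.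
This file carries ZONOTOPE-NESS WITH THE ZONE COUNT through the located-face transport — a face of a zonotope is a translate of a
sub-zonotope (the zones orthogonal to the face functional), a linear image of a zonotope is a zonotope with at most as many zones:

* ★ `subsetSum_face` — the maximisers of a linear functional over the subset-sum family `{w + Σ_{i∈S} gen i : S ⊆ [M]}` ARE a
  subset-sum family with at most `M` zones (sub-cube invariant, cf. ✓ `FaceBlind.SubcubeInvariant`);
* `transport_step_zono`, ★ `transport_geometric_zono` — `Newt(NN_n) + Z ⟶ COR(K_h) + Z'`, `Z'` a zonotope with `≤ M` zones, `h ≥ c·g`;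
* ★★ `nn_zonotope_fewZones` — THE FEW-ZONES LAW READ ON `NN_n` (explicit form): for `r ≥ 1`, `n ≥ (r+1)(2r+1)`, `2g ≤ r`, `g ≥ t₀`,
  every cofactor-side zonotope passenger with `M` zones and every size-`s` EF of `Newt(NN_n) + Z`: some `h ≥ c·g` has, for every
  `C, t` with `1 ≤ t`, `(2(log₂h+C)^C+4)·t ≤ h`, `M·C(h−t−1,t−1) < C(h−1,t−1)`: `2^((log₂ h+C)^C) < s`.

The route-rate corollary (cofactors whose Newton polytope is a zonotope with polynomially many zones — e.g. ALL products of powers of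
univariate / binomial / collinear-support polynomials, `hh = x^w · Π_i p_i(x^{v_i})^{D_i}`, any number of factors, any degrees) is the
sibling `…NNDivisionHardZonotopeCofactors`.

MECHANISM: K1's located face `queueGridZeroOnePoints_holds`, c1's `corMap_image_queueGridPP`, AFHMS's clique face
`AboulkerEtAl2019_gridCorCliqueFace`, `HasEFOfSize.face_add_face₁`, `hasEFOfSize_image_add` (as in ✓ `…FewGeneratorsTransport`), with the
invariant «`range q` = a subset-sum family with `≤ M` zones» (written as a lambda; at the COR end it is `FaceBlind.subsetSum` by `rfl`).
No definitions, no named facts, no sorry.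

HONEST FRAMING: transport lemmas toward a restriction theorem (a decided sub-class of cofactors), NOT the crux: stmt-21181
`NNDivisionHard` OPEN; `CovZonoHard` (general zonotopal passengers) OPEN; COR-VIRTUAL OPEN; `NNNotVP` OPEN; `VP ≠ VNP` NOT proved.
References: Fiorini et al. 2015 Lemma 9 [FioriniEtAl2015]; Kaibel–Weltge 2015 [KaibelWeltge2014]; AFHMS 2019 [AboulkerEtAl2019].
-/

set_option autoImplicit false

-- the mandated summit-side namespace repeats a component by design (single-problem summit)
set_option linter.dupNamespace false

noncomputable section

open Matrix Finset
open scoped Pointwise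

namespace Summit.ValiantsHypothesis.ValiantsHypothesis.Theorems.FifoMatching

namespace Zono

open Literature.Barriers.PneNP (HasEFOfSize sum_dotProduct_le_sum_of_valid inter_eqs_eq_inter_sum_of_valid)
open Literature.Combinatorics.Optimization (corPolytopeGraph)
open Summit.ValiantsHypothesis.ValiantsHypothesis.Theorems.FifoMatching.XcDivision
open Summit.ValiantsHypothesis.ValiantsHypothesis.Theorems.FifoMatching.LowDim (newt_inter_zeroSet_eq)
open MvPolynomial
open scoped NNReal
open Literature.Computability.AlgebraicComplexity (complexity nestFreeMatchingPoly)
open Literature.Algebra.Polynomial.NewtonPolytope (newtonPolytope newtonPolytope_mul)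
open Summit.ValiantsHypothesis.ValiantsHypothesis.Theorems.FifoMatching.QueueGridFace
  (realOf suppPts newt QGV patternVec queueGridPP corMap corMap_image_queueGridPP newt_nonneg)
open Summit.ValiantsHypothesis.ValiantsHypothesis.Theorems.FifoMatching.GridCorShadow (queueGridZeroOnePoints_holds)
open Summit.ValiantsHypothesis.ValiantsHypothesis.Theorems.FifoMatching.MonomialCofactor (newt_eq_newtonPolytope)
open Literature.Combinatorics.Optimization (AboulkerEtAl2019_gridCorCliqueFace)
open Summit.ValiantsHypothesis.ValiantsHypothesis.Theorems.FifoMatching.FaceBlind (subsetSum fewZones_decided)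

/-! ## §1 Faces and linear images of subset-sum families -/

/-- ★ **SUB-CUBE INVARIANT, set form**: the maximisers of `φ` over the subset-sum family `S ↦ w + Σ_{i∈S} gen i` form the subset-sum
family of the zones ORTHOGONAL to `φ`, translated by `w + Σ_{φ·gen i > 0} gen i`; in particular a face of a zonotope with `M` zones is
(generated by) a subset-sum family with at most `M` zones. [folklore] -/
theorem subsetSum_face {ι : Type} [Fintype ι] {M : ℕ} (gen : Fin M → ι → ℝ) (w : ι → ℝ) (φ : ι → ℝ) :
    ∃ (M' : ℕ) (gen' : Fin M' → ι → ℝ) (w' : ι → ℝ) (δ : ℝ), M' ≤ M ∧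
      (∀ S : Finset (Fin M), φ ⬝ᵥ (w + ∑ i ∈ S, gen i) ≤ δ) ∧
      {x | x ∈ Set.range (fun S : Finset (Fin M) => w + ∑ i ∈ S, gen i) ∧ φ ⬝ᵥ x = δ} =
        Set.range (fun S' : Finset (Fin M') => w' + ∑ i ∈ S', gen' i) := by
  classical
  let Tp : Finset (Fin M) := Finset.univ.filter fun i => 0 < φ ⬝ᵥ gen i
  let T0 : Finset (Fin M) := Finset.univ.filter fun i => φ ⬝ᵥ gen i = 0
  let e : Fin T0.card ↪ Fin M := (T0.orderEmbOfFin rfl).toEmbedding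
  have he : ∀ j, e j ∈ T0 := fun j => Finset.orderEmbOfFin_mem _ rfl j
  have he' : ∀ i ∈ T0, ∃ j, e j = i := fun i hi => by
    have : i ∈ Set.range (T0.orderEmbOfFin rfl) := by rw [Finset.range_orderEmbOfFin]; exact hi
    obtain ⟨j, hj⟩ := this
    exact ⟨j, hj⟩
  set δ : ℝ := φ ⬝ᵥ w + ∑ i ∈ Tp, φ ⬝ᵥ gen i with hδ
  have hval : ∀ S : Finset (Fin M), φ ⬝ᵥ (w + ∑ i ∈ S, gen i) = φ ⬝ᵥ w + ∑ i ∈ S, φ ⬝ᵥ gen i := by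
    intro S; rw [dotProduct_add, dotProduct_sum]
  -- the value of a subset is at most `δ`, with equality iff `Tp ⊆ S ⊆ Tp ∪ T0`
  have hnonpos : ∀ S : Finset (Fin M), ∀ i ∈ S.filter (fun i => i ∉ Tp), φ ⬝ᵥ gen i ≤ 0 := by
    intro S i hi
    have hi' := (Finset.mem_filter.1 hi).2
    simp only [Tp, Finset.mem_filter, Finset.mem_univ, true_and, not_lt] at hi'
    exact hi'
  have hTp_nonneg : ∀ i ∈ Tp, 0 ≤ φ ⬝ᵥ gen i := fun i hi => le_of_lt (by simpa [Tp] using hi)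
  have hsplit : ∀ S : Finset (Fin M), ∑ i ∈ S.filter (fun i => i ∈ Tp), φ ⬝ᵥ gen i +
      ∑ i ∈ S.filter (fun i => i ∉ Tp), φ ⬝ᵥ gen i = ∑ i ∈ S, φ ⬝ᵥ gen i :=
    fun S => Finset.sum_filter_add_sum_filter_not S (fun i => i ∈ Tp) _
  have hA_sub : ∀ S : Finset (Fin M), S.filter (fun i => i ∈ Tp) ⊆ Tp := fun S i hi => (Finset.mem_filter.1 hi).2
  have hA_le : ∀ S : Finset (Fin M), ∑ i ∈ S.filter (fun i => i ∈ Tp), φ ⬝ᵥ gen i ≤ ∑ i ∈ Tp, φ ⬝ᵥ gen i :=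
    fun S => Finset.sum_le_sum_of_subset_of_nonneg (hA_sub S) fun i hi _ => hTp_nonneg i hi
  have hB_le : ∀ S : Finset (Fin M), ∑ i ∈ S.filter (fun i => i ∉ Tp), φ ⬝ᵥ gen i ≤ 0 :=
    fun S => Finset.sum_nonpos (hnonpos S)
  have hle : ∀ S : Finset (Fin M), φ ⬝ᵥ (w + ∑ i ∈ S, gen i) ≤ δ := fun S => by
    rw [hval, ← hsplit S]; linarith [hA_le S, hB_le S]
  have heq : ∀ S : Finset (Fin M), φ ⬝ᵥ (w + ∑ i ∈ S, gen i) = δ → Tp ⊆ S ∧ S ⊆ Tp ∪ T0 := by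
    intro S hS
    rw [hval, hδ, add_right_inj, ← hsplit S] at hS
    have h1' : ∑ i ∈ S.filter (fun i => i ∉ Tp), φ ⬝ᵥ gen i = 0 := by linarith [hA_le S, hB_le S]
    have h2' : ∑ i ∈ S.filter (fun i => i ∈ Tp), φ ⬝ᵥ gen i = ∑ i ∈ Tp, φ ⬝ᵥ gen i := by
      linarith [hA_le S, hB_le S]
    constructor
    · -- missing a positive zone would lose value
      by_contra hnot
      obtain ⟨i, hiT, hiS⟩ := Finset.not_subset.1 hnot
      have hpos : 0 < φ ⬝ᵥ gen i := by simpa [Tp] using hiT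
      have hiA : i ∉ S.filter (fun i => i ∈ Tp) := fun h => hiS (Finset.mem_filter.1 h).1
      have hlt : ∑ j ∈ S.filter (fun i => i ∈ Tp), φ ⬝ᵥ gen j < ∑ j ∈ Tp, φ ⬝ᵥ gen j :=
        Finset.sum_lt_sum_of_subset (hA_sub S) hiT hiA hpos fun j hj _ => hTp_nonneg j hj
      linarith
    · intro i hi
      by_cases hiT : i ∈ Tp
      · exact Finset.mem_union_left _ hiT
      · have hmem : i ∈ S.filter (fun i => i ∉ Tp) := Finset.mem_filter.2 ⟨hi, hiT⟩
        have hz := (Finset.sum_eq_zero_iff_of_nonpos (hnonpos S)).1 h1' i hmem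
        exact Finset.mem_union_right _ (by simp [T0, hz])
  refine ⟨T0.card, gen ∘ e, w + ∑ i ∈ Tp, gen i, δ, ?_, hle, ?_⟩
  · exact (Finset.card_le_univ T0).trans_eq (Fintype.card_fin M)
  ext x
  simp only [Set.mem_setOf_eq, Set.mem_range, Function.comp_apply]
  constructor
  · rintro ⟨⟨S, rfl⟩, hS⟩
    obtain ⟨hTS, hST⟩ := heq S hS
    refine ⟨Finset.univ.filter fun j => e j ∈ S, ?_⟩
    have hdecomp : S = Tp ∪ (S ∩ T0) := by
      ext i
      simp only [Finset.mem_union, Finset.mem_inter]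
      constructor
      · intro hi
        rcases Finset.mem_union.1 (hST hi) with h | h
        · exact Or.inl h
        · exact Or.inr ⟨hi, h⟩
      · rintro (h | ⟨h, -⟩)
        · exact hTS h
        · exact h
    have hdisj : Disjoint Tp (S ∩ T0) := by
      rw [Finset.disjoint_left]
      intro i hi hi'
      have h0 := (Finset.mem_inter.1 hi').2
      have hpos : 0 < φ ⬝ᵥ gen i := by simpa [Tp] using hi
      have hz : φ ⬝ᵥ gen i = 0 := by simpa [T0] using h0
      linarith
    have himg : (Finset.univ.filter fun j => e j ∈ S).map e = S ∩ T0 := by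
      ext i
      simp only [Finset.mem_map, Finset.mem_filter, Finset.mem_univ, true_and, Finset.mem_inter]
      constructor
      · rintro ⟨j, hj, rfl⟩
        exact ⟨hj, he j⟩
      · rintro ⟨hiS, hiT⟩
        obtain ⟨j, rfl⟩ := he' i hiT
        exact ⟨j, hiS, rfl⟩
    have hsum : ∑ j ∈ Finset.univ.filter (fun j => e j ∈ S), gen (e j) = ∑ i ∈ S ∩ T0, gen i := by
      rw [← himg, Finset.sum_map]
    rw [hsum, add_assoc, ← Finset.sum_union hdisj, ← hdecomp]
  · rintro ⟨S', rfl⟩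
    have hdisj : Disjoint Tp (S'.map e) := by
      rw [Finset.disjoint_left]
      intro i hi hi'
      obtain ⟨j, -, rfl⟩ := Finset.mem_map.1 hi'
      have h0 := he j
      have hpos : 0 < φ ⬝ᵥ gen (e j) := by simpa [Tp] using hi
      have hz : φ ⬝ᵥ gen (e j) = 0 := by simpa [T0] using h0
      linarith
    refine ⟨⟨Tp ∪ S'.map e, by rw [Finset.sum_union hdisj, Finset.sum_map, add_assoc]⟩, ?_⟩
    have hz : ∀ j ∈ S', φ ⬝ᵥ gen (e j) = 0 := fun j _ => by simpa [T0] using he j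
    rw [dotProduct_add, dotProduct_sum, Finset.sum_eq_zero hz, add_zero, hδ, dotProduct_add, dotProduct_sum]

/-- linear images of subset-sum families are subset-sum families (same index set). [folklore] -/
theorem map_subsetSum {ι κ : Type} {M : ℕ} (L : (ι → ℝ) →ₗ[ℝ] (κ → ℝ)) (gen : Fin M → ι → ℝ) (w : ι → ℝ)
    (S : Finset (Fin M)) : L (w + ∑ i ∈ S, gen i) = L w + ∑ i ∈ S, (⇑L ∘ gen) i := by
  rw [map_add, map_sum]; rfl

/-! ## §2 The transport WITH the number of zones -/

/-- **ONE TRANSPORT STEP, with the number of zones**: if `P + Z` has an extended formulation of size `r`, `Z` the hull of a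
subset-sum family with `M` zones, `φ · x ≤ δ` is valid on `P` and `L` is linear, then `L(P ∩ {φ · x = δ}) + Z'` has an extended
formulation of size `r` for `Z'` the hull of a subset-sum family with at most `M` zones (faces and linear images distribute over
Minkowski sums; `subsetSum_face`). [cite: FioriniEtAl2015, Lemma 9] -/
theorem transport_step_zono {ι κ : Type} [Fintype ι] [Fintype κ] {M : ℕ}
    {P : Set (ι → ℝ)} (gen : Fin M → ι → ℝ) (w : ι → ℝ) {r : ℕ}
    (h : HasEFOfSize (P + convexHull ℝ (Set.range fun S : Finset (Fin M) => w + ∑ i ∈ S, gen i)) r)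
    (φ : ι → ℝ) (δ : ℝ) (hP : ∀ x ∈ P, φ ⬝ᵥ x ≤ δ) (L : (ι → ℝ) →ₗ[ℝ] (κ → ℝ)) :
    ∃ (M' : ℕ) (gen' : Fin M' → κ → ℝ) (w' : κ → ℝ), M' ≤ M ∧
      HasEFOfSize (L '' (P ∩ {x | φ ⬝ᵥ x = δ}) +
        convexHull ℝ (Set.range fun S : Finset (Fin M') => w' + ∑ i ∈ S, gen' i)) r := by
  classical
  obtain ⟨M', gen₁, w₁, δQ, hM', hle, hface⟩ := subsetSum_face gen w φ
  have hQ : ∀ y ∈ convexHull ℝ (Set.range fun S : Finset (Fin M) => w + ∑ i ∈ S, gen i), φ ⬝ᵥ y ≤ δQ :=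
    dot_le_of_mem_convexHull _ φ _ (by rintro _ ⟨S, rfl⟩; exact hle S)
  have h2 := hasEFOfSize_image_add (h.face_add_face₁ φ δ δQ hP hQ) L
  rw [convexHull_range_inter_eq _ φ δQ hle, LinearMap.image_convexHull] at h2
  have hrange : Set.range (fun j : {S : Finset (Fin M) // φ ⬝ᵥ (w + ∑ i ∈ S, gen i) = δQ} =>
      w + ∑ i ∈ j.1, gen i) = Set.range (fun S' : Finset (Fin M') => w₁ + ∑ i ∈ S', gen₁ i) := by
    rw [← hface]
    ext x
    simp only [Set.mem_range, Set.mem_setOf_eq]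
    constructor
    · rintro ⟨⟨S, hS⟩, rfl⟩
      exact ⟨⟨S, rfl⟩, hS⟩
    · rintro ⟨⟨S, rfl⟩, hx⟩
      exact ⟨⟨S, hx⟩, rfl⟩
  rw [hrange, ← Set.range_comp] at h2
  refine ⟨M', ⇑L ∘ gen₁, L w₁, hM', ?_⟩
  have hcomp : (⇑L ∘ fun S' : Finset (Fin M') => w₁ + ∑ i ∈ S', gen₁ i) =
      fun S' : Finset (Fin M') => L w₁ + ∑ i ∈ S', (⇑L ∘ gen₁) i := by
    funext S'
    exact map_subsetSum L gen₁ w₁ S'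
  rw [hcomp] at h2
  exact h2

/-- ★ **THE GEOMETRIC TRANSPORT WITH THE NUMBER OF ZONES (PROVED)**: as `FewGenerators.transport_geometric_card`, for a ZONOTOPE
passenger `Z = conv{w + Σ_{i∈S} gen i : S ⊆ [M]}` of `Newt(NN_n)`: with AFHMS's constants `c, t₀`, for `r ≥ 1`, `n ≥ (r+1)(2r+1)`,
`2g ≤ r`, `g ≥ t₀` and every size-`s` extended formulation of `Newt(NN_n) + Z` there are `h ≥ c·g` and a zonotope `Z'` of `ℝ^{h×h}`
with at most `M` zones and a size-`s` extended formulation of `COR(K_h) + Z'`.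
[cite: AboulkerEtAl2019, pp. 5–6 (grid-minor clique face)] [cite: FioriniEtAl2015, Lemma 9] -/
theorem transport_geometric_zono :
    ∃ c : ℝ, 0 < c ∧ ∃ t₀ : ℕ, ∀ (n r g : ℕ), 1 ≤ r → (r + 1) * (2 * r + 1) ≤ n → ∀ (hg : 2 * g ≤ r), t₀ ≤ g →
      ∀ {M : ℕ} (gen : Fin M → (Fin (2 * n) × Fin (2 * n)) → ℝ) (w : (Fin (2 * n) × Fin (2 * n)) → ℝ) (s : ℕ),
        HasEFOfSize (newt (nestFreeMatchingPoly n ℝ≥0) +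
          convexHull ℝ (Set.range fun S : Finset (Fin M) => w + ∑ i ∈ S, gen i)) s →
          ∃ h : ℕ, c * g ≤ h ∧ ∃ (M' : ℕ) (gen' : Fin M' → (Fin h × Fin h → ℝ)) (w' : Fin h × Fin h → ℝ), M' ≤ M ∧
            HasEFOfSize (corPolytopeGraph (⊤ : SimpleGraph (Fin h)) + convexHull ℝ (Set.range (subsetSum gen' w'))) s := by
  classical
  obtain ⟨c, hc, t₀, hface⟩ := AboulkerEtAl2019_gridCorCliqueFace
  refine ⟨c, hc, t₀, fun n r g hr hn hg ht M gen w s hEF' => ?_⟩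
  -- Step 1: the A1 coordinate face, read out onto `PP_r`
  obtain ⟨Z, f, hA1⟩ := queueGridZeroOnePoints_holds r n hr hn
  let φ : (Fin (2 * n) × Fin (2 * n)) → ℝ := fun e => if e ∈ Z then (-1 : ℝ) else 0
  have hφ : ∀ x : (Fin (2 * n) × Fin (2 * n)) → ℝ, φ ⬝ᵥ x = -∑ e ∈ Z, x e := by
    intro x
    simp only [dotProduct, φ, ite_mul, neg_one_mul, zero_mul]
    rw [Finset.sum_ite_mem, Finset.univ_inter, Finset.sum_neg_distrib]
  have hP : ∀ x ∈ newt (nestFreeMatchingPoly n ℝ≥0), φ ⬝ᵥ x ≤ 0 := fun x hx => by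
    rw [hφ]; exact neg_nonpos.2 (Finset.sum_nonneg fun e _ => newt_nonneg _ x hx e)
  let Lf : ((Fin (2 * n) × Fin (2 * n)) → ℝ) →ₗ[ℝ] ((QGV r × QGV r) × Bool × Bool → ℝ) :=
    LinearMap.funLeft ℝ ℝ f
  obtain ⟨M₁, gen₁, w₁, hM₁, h₁⟩ := transport_step_zono gen w hEF' φ 0 hP Lf
  have hF : Lf '' (newt (nestFreeMatchingPoly n ℝ≥0) ∩ {x | φ ⬝ᵥ x = 0}) = queueGridPP r := by
    rw [newt_inter_zeroSet_eq, LinearMap.image_convexHull]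
    unfold queueGridPP
    congr 1
  rw [hF] at h₁
  -- Step 2: c1's coordinate-linear map onto `COR(G_g)`
  have h₂ := hasEFOfSize_image_add h₁ (corMap r g hg)
  rw [corMap_image_queueGridPP, LinearMap.image_convexHull, ← Set.range_comp,
    ← Summit.ValiantsHypothesis.ValiantsHypothesis.Theorems.FifoMatching.QueueGridFace.corPolytopeGraph_eq] at h₂
  have hcomp : (⇑(corMap r g hg) ∘ fun S : Finset (Fin M₁) => w₁ + ∑ i ∈ S, gen₁ i) =
      fun S : Finset (Fin M₁) => corMap r g hg w₁ + ∑ i ∈ S, (⇑(corMap r g hg) ∘ gen₁) i := by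
    funext S
    exact map_subsetSum (corMap r g hg) gen₁ w₁ S
  rw [hcomp] at h₂
  -- Step 3: AFHMS's face of `COR(G_g)` onto `COR(K_h)`, as ONE valid functional
  obtain ⟨h, hch, k, cv, δ, π, hvalid, hπ⟩ := hface g ht
  obtain ⟨M₃, gen₃, w₃, hM₃, h₃⟩ := transport_step_zono (⇑(corMap r g hg) ∘ gen₁) (corMap r g hg w₁) h₂
    (∑ i, cv i) (∑ i, δ i) (sum_dotProduct_le_sum_of_valid _ cv δ hvalid) π
  rw [← inter_eqs_eq_inter_sum_of_valid _ cv δ hvalid, hπ] at h₃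
  exact ⟨h, hch, M₃, gen₃, w₃, hM₃.trans hM₁, h₃⟩

/-! ## §3 The FEW-ZONES LAW read on `NN_n` (explicit form) -/

/-- ★★ **THE FEW-ZONES LAW READ ON `NN_n` (explicit form, PROVED):** with AFHMS's constants `c, t₀`: for `r ≥ 1`, `n ≥ (r+1)(2r+1)`,
`2g ≤ r`, `g ≥ t₀`, every zonotope passenger `Z = conv{w + Σ_{i∈S} gen i : S ⊆ [M]}` and every size-`s` extended formulation of
`Newt(NN_n) + Z`, there is `h ≥ c·g` such that for all `C, t` with `1 ≤ t`, `(2(log₂ h + C)^C + 4)·t ≤ h` and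
`M·C(h−t−1, t−1) < C(h−1, t−1)`: `2^((log₂ h + C)^C) < s` — whatever the zone vectors `gen i`.
[cite: KaibelWeltge2014, Thm. 1] [cite: FioriniEtAl2015, Thm. 7] -/
theorem nn_zonotope_fewZones :
    ∃ c : ℝ, 0 < c ∧ ∃ t₀ : ℕ, ∀ (n r g : ℕ), 1 ≤ r → (r + 1) * (2 * r + 1) ≤ n → 2 * g ≤ r → t₀ ≤ g →
      ∀ {M : ℕ} (gen : Fin M → (Fin (2 * n) × Fin (2 * n)) → ℝ) (w : (Fin (2 * n) × Fin (2 * n)) → ℝ) (s : ℕ),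
        HasEFOfSize (newtonPolytope (MvPolynomial.map NNReal.toRealHom (nestFreeMatchingPoly n ℝ≥0)) +
          convexHull ℝ (Set.range fun S : Finset (Fin M) => w + ∑ i ∈ S, gen i)) s →
          ∃ h : ℕ, c * g ≤ h ∧ ∀ (C t : ℕ), 1 ≤ t → (2 * (Nat.log 2 h + C) ^ C + 4) * t ≤ h →
            M * Nat.choose (h - t - 1) (t - 1) < Nat.choose (h - 1) (t - 1) → 2 ^ ((Nat.log 2 h + C) ^ C) < s := by
  obtain ⟨c, hc, t₀, H⟩ := transport_geometric_zono
  refine ⟨c, hc, t₀, fun n r g hr hn hg ht M gen w s hEF => ?_⟩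
  have hEF' : HasEFOfSize (newt (nestFreeMatchingPoly n ℝ≥0) +
      convexHull ℝ (Set.range fun S : Finset (Fin M) => w + ∑ i ∈ S, gen i)) s := by
    rw [newt_eq_newtonPolytope]; exact hEF
  obtain ⟨h, hch, M', gen', w', hM', hR⟩ := H n r g hr hn hg ht gen w s hEF'
  refine ⟨h, hch, fun C t ht1 hht hcount => ?_⟩
  exact fewZones_decided C h t M' gen' w' s ht1 hht
    (lt_of_le_of_lt (Nat.mul_le_mul_right _ hM') hcount) hR

end Zono

end Summit.ValiantsHypothesis.ValiantsHypothesis.Theorems.FifoMatching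

end
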